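import Summits.CriticalPhenomena.CardyFormulaZ2.Theorems.CardySusyWardDiscretisationFamilyExistsLegC1
import HarnessLib

/-!
# The leg of shape C3E (hook crossing) — helper for `DiscretisationFamilyExists` (stmt-CriticalPhenomena-9644)

Standard orientation, coordinates of `Mesh.cell`, bare data `⟨Ω, δ, ∅, ∅⟩` on a regular open set.
From a hook datum — column `k` clean on rows `y₃ … R`, the cells `(k+1, y'+1)` and `(k+1, y')`
inner and reached across non-chord sides, `(k+1, y'-1)` not inner, the bottom edge
`[(k+1, y'), (k+2, y')]` non-degenerate — `legData_C3E` builds the `LegData` of the leg: plug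
`P` = `segment m N ∪ segment N C ∪ X` (`m`, `N`, `C` the centres of `(k, y'+1)`, `(k+1, y'+1)`,
`(k+1, y')`, `X` the exit arc from `C` through the midpoint `P*` of the bottom edge into
`(k+1, y'-1)`), run = the vertical segment from `m` to the centre of `(k, R)`, cut edge
`u = (k+1, y')`, `v = (k+2, y')` (`mv = 0`), sector point `z₀ = (δ(k+3/2), δ(y'+¼))`, `ε = δ/8`.
Everything near the cut is as for the straight crossing (`…ExistsLegC1`), the other pieces of the
plug and the run lie at `im ≥ δ(y'+3/2)` or in column `k`.
-/

noncomputable section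

open Set Metric Complex
open Literature.Probability.LatticeModels Literature.Probability.Percolation
  Literature.Probability.LatticeModels.Mesh Literature.Probability.LatticeModels.DiscreteDobrushin
  Literature.Topology.PlaneTopology

namespace Summit.CriticalPhenomena.CardyFormulaZ2.Theorems.DiscretisationFamilyExists

/-! ### The leg of shape C3E -/

set_option maxHeartbeats 800000 in
/-- **The `LegData` of a hook crossing (shape C3E).** See the module docstring. [folklore] -/
theorem legData_C3E {Ω : Set ℂ} {δ : ℝ} (hΩ : IsOpen Ω)
    (hJE : frontier Ω ⊆ closure (closure Ω)ᶜ) (hext : IsConnected (closure Ω)ᶜ)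
    (hunb : ¬ Bornology.IsBounded (closure Ω)ᶜ) (hδ : 0 < δ) {k y' R y₃ : ℤ} (hyR : y' + 1 < R) (hy₃ : y₃ ≤ y' + 1)
    (hcol : ∀ j : ℤ, y₃ ≤ j → j ≤ R → (⟨Ω, δ, ∅, ∅⟩ : DiscreteDobrushin).IsInnerFace ![k, j] ∧
      ¬ (((![k, j + 1] : Site 2) ∈ (⟨Ω, δ, ∅, ∅⟩ : DiscreteDobrushin).zdBoundary) ∧
        ((![k + 1, j + 1] : Site 2) ∈ (⟨Ω, δ, ∅, ∅⟩ : DiscreteDobrushin).zdBoundary)))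
    (hN : (⟨Ω, δ, ∅, ∅⟩ : DiscreteDobrushin).IsInnerFace ![k + 1, y' + 1])
    (hQ : (⟨Ω, δ, ∅, ∅⟩ : DiscreteDobrushin).IsInnerFace ![k + 1, y'])
    (hside₁ : ¬ (((![k + 1, y' + 1] : Site 2) ∈ (⟨Ω, δ, ∅, ∅⟩ : DiscreteDobrushin).zdBoundary) ∧
      ((![k + 1, y' + 2] : Site 2) ∈ (⟨Ω, δ, ∅, ∅⟩ : DiscreteDobrushin).zdBoundary)))
    (hside₂ : ¬ (((![k + 1, y' + 1] : Site 2) ∈ (⟨Ω, δ, ∅, ∅⟩ : DiscreteDobrushin).zdBoundary) ∧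
      ((![k + 2, y' + 1] : Site 2) ∈ (⟨Ω, δ, ∅, ∅⟩ : DiscreteDobrushin).zdBoundary)))
    (hQ' : ¬ (⟨Ω, δ, ∅, ∅⟩ : DiscreteDobrushin).IsInnerFace ![k + 1, y' - 1])
    (hnd : ¬ (δ + infDist (meshPoint δ ![k + 1, y']) (frontier Ω) ≤ infDist (meshPoint δ ![k + 2, y']) (frontier Ω)) ∧
      ¬ (δ + infDist (meshPoint δ ![k + 2, y']) (frontier Ω) ≤ infDist (meshPoint δ ![k + 1, y']) (frontier Ω)))
    {a p : ℂ} {η : ℝ} (hp : dist (cellCenter δ k R) p ≤ 2 * δ)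
    (hwin : ∀ z : ℂ, δ * (k - 4) ≤ z.re → z.re ≤ δ * (k + 5) → δ * (y' - 2) ≤ z.im → z.im ≤ δ * (R + 2) →
      z ∈ ball a η) :
    Nonempty (LegData Ω δ a η p) := by
  obtain ⟨huB, hvB⟩ := mem_zdBoundary_of_inner_not_inner_below hQ hQ'
  rw [show k + 1 + 1 = k + 2 by ring] at hvB
  have hadj : (k + 1 = k + 1 ∧ (y' - 1 = y' + 1 ∨ y' - 1 = y' - 1)) ∨ (y' - 1 = y' ∧ (k + 1 = k + 1 + 1 ∨ k + 1 = k + 1 - 1)) :=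
    Or.inl ⟨rfl, Or.inr rfl⟩
  obtain ⟨c, hc_fr, X, hXarc, hXΩ, hsegX, hXsub, hcF', hXmem, hc_cases⟩ :=
    exists_exitArc (E := (⟨Ω, δ, ∅, ∅⟩ : DiscreteDobrushin)) hΩ hJE hext hunb hδ hQ hQ' hadj
  -- points
  set C := cellCenter δ (k + 1) y' with hC
  set C' := cellCenter δ (k + 1) (y' - 1) with hC'
  set Pstar := (2⁻¹ : ℝ) • (C + C') with hP
  set N := cellCenter δ (k + 1) (y' + 1) with hN'
  set m := cellCenter δ k (y' + 1) with hm
  set ztop := cellCenter δ k R with hztop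
  set z₀ : ℂ := ⟨δ * k + δ + δ / 2, δ * y' + δ / 4⟩ with hz₀
  have hCeq : C = ⟨δ * (k + 3 / 2), δ * (y' + 1 / 2)⟩ := by rw [hC, cellCenter_eq]; push_cast; ring_nf
  have hC'eq : C' = ⟨δ * (k + 3 / 2), δ * (y' - 1 / 2)⟩ := by rw [hC', cellCenter_eq]; push_cast; ring_nf
  have hNeq : N = ⟨δ * (k + 3 / 2), δ * (y' + 3 / 2)⟩ := by rw [hN', cellCenter_eq]; push_cast; ring_nf
  have hmeq : m = ⟨δ * (k + 1 / 2), δ * (y' + 3 / 2)⟩ := by rw [hm, cellCenter_eq]; push_cast; ring_nf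
  have hPeq : Pstar = ⟨δ * (k + 3 / 2), δ * y'⟩ := by
    rw [hP, hCeq, hC'eq]; apply Complex.ext <;> simp <;> ring
  have hueq : meshPoint δ ![k + 1, y'] = ⟨δ * k + δ, δ * y'⟩ := by
    rw [meshPoint_vec']; push_cast; apply Complex.ext <;> simp; ring
  have hveq : meshPoint δ ![k + 2, y'] = ⟨δ * k + δ + δ, δ * y'⟩ := by
    rw [meshPoint_vec']; push_cast; apply Complex.ext <;> simp; ring
  have hyR' : (y' : ℝ) + 2 ≤ R := by exact_mod_cast (show y' + 2 ≤ R by omega)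
  have hwR1 : δ * (y' + 3 / 2) ≤ δ * (R + 2) := mul_le_mul_of_nonneg_left (by linarith) hδ.le
  have hwR2 : δ * y' ≤ δ * (R + 2) := mul_le_mul_of_nonneg_left (by linarith) hδ.le
  -- coordinates of the pieces
  have hrun : ∀ z ∈ segment ℝ m ztop, z.re = δ * (k + 1 / 2) ∧ δ * (y' + 1 + 1 / 2) ≤ z.im ∧ z.im ≤ δ * (R + 1 / 2) :=
    fun z hz => by
      have := re_im_of_mem_vertical_run hδ hyR.le hz
      push_cast at this ⊢; exact this
  have hNC : ∀ z ∈ segment ℝ N C, z.re = δ * (k + 3 / 2) ∧ δ * (y' + 1 / 2) ≤ z.im ∧ z.im ≤ δ * (y' + 3 / 2) := by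
    intro z hz
    rw [segment_symm] at hz
    have := re_im_of_mem_vertical_run hδ (by omega : y' ≤ y' + 1) hz
    push_cast at this
    refine ⟨by rw [this.1]; ring, this.2.1, by linarith [this.2.2]⟩
  have hmN : ∀ z ∈ segment ℝ m N, z.im = δ * (y' + 3 / 2) ∧ δ * (k + 1 / 2) ≤ z.re ∧ z.re ≤ δ * (k + 3 / 2) := by
    intro z hz
    have := re_im_of_mem_horizontal_step hδ hz
    push_cast at this
    refine ⟨by rw [this.1]; ring, this.2.1, this.2.2⟩
  have hdown : ∀ z ∈ segment ℝ C C', z.re = δ * (k + 3 / 2) ∧ δ * (y' - 1 / 2) ≤ z.im ∧ z.im ≤ δ * (y' + 1 / 2) := by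
    intro z hz
    rw [segment_symm] at hz
    have := re_im_of_mem_vertical_run hδ (by omega : y' - 1 ≤ y') hz
    push_cast at this
    refine ⟨by rw [this.1]; ring, by linarith [this.2.1], this.2.2⟩
  have hsegP_sub : segment ℝ C Pstar ⊆ segment ℝ C C' := by
    refine (convex_segment C C').segment_subset (left_mem_segment _ _ _) ?_
    rw [hP]; exact ⟨2⁻¹, 2⁻¹, by norm_num, by norm_num, by norm_num, by rw [smul_add]⟩
  have hsegP : ∀ z ∈ segment ℝ C Pstar, z.re = δ * (k + 3 / 2) ∧ δ * y' ≤ z.im ∧ z.im ≤ δ * (y' + 1 / 2) := by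
    intro z hz
    refine ⟨(hdown z (hsegP_sub hz)).1, ?_, (hdown z (hsegP_sub hz)).2.2⟩
    rw [segment_eq_image'] at hz
    obtain ⟨θ, ⟨h0, h1⟩, rfl⟩ := hz
    rw [hCeq, hPeq]; simp; linarith [mul_nonneg hδ.le h0, mul_nonneg hδ.le (sub_nonneg.2 h1)]
  have hcell' : ∀ z ∈ cell δ (k + 1) (y' - 1), δ * (k + 1) < z.re ∧ z.re < δ * (k + 2) ∧ δ * (y' - 1) < z.im ∧ z.im < δ * y' := by
    intro z hz
    rw [mem_cell_iff] at hz; push_cast at hz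
    exact ⟨hz.1.1, by linarith [hz.1.2], hz.2.1, by linarith [hz.2.2]⟩
  have hcl' : ∀ z ∈ closure (cell δ (k + 1) (y' - 1)), δ * (k + 1) ≤ z.re ∧ z.re ≤ δ * (k + 2) ∧ δ * (y' - 1) ≤ z.im ∧ z.im ≤ δ * y' := by
    intro z hz
    rw [closure_cell hδ, mem_reProdIm] at hz; push_cast at hz
    exact ⟨hz.1.1, by linarith [hz.1.2], hz.2.1, by linarith [hz.2.2]⟩
  have hXΩmem : ∀ z ∈ X, z ∈ Ω → z ∈ segment ℝ C Pstar ∨ z ∈ cell δ (k + 1) (y' - 1) := hXmem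
  have hfull : cell δ (k + 1) y' ⊆ Ω := isFull_of_isInnerFace (E := (⟨Ω, δ, ∅, ∅⟩ : DiscreteDobrushin)) hΩ hJE hext hunb hδ hQ
  have huΩ : meshPoint δ ![k + 1, y'] ∈ Ω :=
    meshDomain_subset_meshVertices _ _ (DiscreteDobrushin.zdBoundary_subset_meshDomain _ huB)
  have hvΩ : meshPoint δ ![k + 2, y'] ∈ Ω :=
    meshDomain_subset_meshVertices _ _ (DiscreteDobrushin.zdBoundary_subset_meshDomain _ hvB)
  have hcΩ : c ∉ Ω := (hΩ.frontier_eq ▸ hc_fr).2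
  obtain ⟨hcre1, hcre2, hcim1, hcim2⟩ := hcl' c hcF'
  have hz₀seg : z₀ ∈ segment ℝ C Pstar := by
    refine ⟨2⁻¹, 2⁻¹, by norm_num, by norm_num, by norm_num, ?_⟩
    rw [hCeq, hPeq, hz₀]; apply Complex.ext <;> simp <;> ring
  -- the plug and the leg
  set P := (segment ℝ m N ∪ segment ℝ N C) ∪ X with hPdef
  -- trichotomy for points of the leg in `Ω`
  have hre_or : ∀ z ∈ P ∪ segment ℝ m ztop, z ∈ Ω →
      (z.re = δ * k + δ + δ / 2 ∧ δ * y' ≤ z.im) ∨ z ∈ cell δ (k + 1) (y' - 1) ∨ δ * y' + δ * (3 / 2) ≤ z.im := by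
    rintro z ((( hz | hz) | hz) | hz) hzΩ
    · exact Or.inr (Or.inr (by rw [(hmN z hz).1]; ring_nf; rfl))
    · exact Or.inl ⟨by rw [(hNC z hz).1]; ring, by linarith [(hNC z hz).2.1]⟩
    · rcases hXΩmem z hz hzΩ with h' | h'
      · exact Or.inl ⟨by rw [(hsegP z h').1]; ring, (hsegP z h').2.1⟩
      · exact Or.inr (Or.inl h')
    · exact Or.inr (Or.inr (by linarith [(hrun z hz).2.1]))
  -- m ≠ ztop
  have h_m_ne : m ≠ ztop := by
    intro h
    have := congrArg Complex.im h
    rw [hmeq, hztop, cellCenter_eq] at this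
    simp only at this
    have : (y' : ℝ) + 1 = R := by have := mul_left_cancel₀ hδ.ne' this; linarith
    have : y' + 1 = R := by exact_mod_cast this
    omega
  -- the plug is a simple arc from `m` to `c`
  have hmN_ne : m ≠ N := by
    intro h; have := congrArg Complex.re h; rw [hmeq, hNeq] at this; simp only at this
    have := mul_left_cancel₀ hδ.ne' this; linarith
  have hNC_ne : N ≠ C := by
    intro h; have := congrArg Complex.im h; rw [hNeq, hCeq] at this; simp only at this
    have := mul_left_cancel₀ hδ.ne' this; linarith
  have h_arcP : IsSimpleArc P m c := by
    have h1 : IsSimpleArc (segment ℝ m N ∪ segment ℝ N C) m C := by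
      refine (IsSimpleArc.segment hmN_ne).union (IsSimpleArc.segment hNC_ne) ?_
      rintro z ⟨hz1, hz2⟩
      obtain ⟨him, -, hre2⟩ := hmN z hz1
      obtain ⟨hre, -, -⟩ := hNC z hz2
      rw [mem_singleton_iff, hNeq]
      exact Complex.ext hre him
    refine h1.union hXarc ?_
    rintro z ⟨hz1 | hz1, hz2⟩
    · exfalso
      obtain ⟨him, -, -⟩ := hmN z hz1
      rcases hXsub hz2 with h | h
      · obtain ⟨-, -, him2⟩ := hdown z h; linarith
      · obtain ⟨-, -, -, him2⟩ := hcl' z h; linarith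
    · obtain ⟨hre, him1, -⟩ := hNC z hz1
      rw [mem_singleton_iff, hCeq]
      rcases hXsub hz2 with h | h
      · obtain ⟨-, -, him2⟩ := hdown z h
        exact Complex.ext hre (le_antisymm him2 him1)
      · obtain ⟨-, -, -, him2⟩ := hcl' z h; exfalso; linarith
  -- P ∩ run = {m}
  have h_inter : P ∩ segment ℝ m ztop = {m} := by
    ext z
    simp only [mem_inter_iff, mem_singleton_iff]
    constructor
    · rintro ⟨hzP, hzr⟩
      obtain ⟨hre, him1, -⟩ := hrun z hzr
      rcases hzP with (hz | hz) | hz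
      · obtain ⟨him, -, -⟩ := hmN z hz
        rw [hmeq]; exact Complex.ext hre him
      · obtain ⟨hre2, -, -⟩ := hNC z hz
        exfalso; rw [hre] at hre2; have := mul_left_cancel₀ hδ.ne' hre2; linarith
      · exfalso
        rcases hXsub hz with h | h
        · obtain ⟨hre2, -, -⟩ := hdown z h
          rw [hre] at hre2; have := mul_left_cancel₀ hδ.ne' hre2; linarith
        · obtain ⟨hre2, -, -, -⟩ := hcl' z h; rw [hre] at hre2; nlinarith
    · intro h; rw [h]
      exact ⟨Or.inl (Or.inl (left_mem_segment _ _ _)), left_mem_segment _ _ _⟩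
  -- plug ⊆ Ω but for `c`
  have h_PΩ : P \ {c} ⊆ Ω := by
    rintro z ⟨(hz | hz) | hz, hzc⟩
    · exact horizontal_step_subset (E := (⟨Ω, δ, ∅, ∅⟩ : DiscreteDobrushin)) hΩ hJE hext hunb hδ
        (hcol (y' + 1) hy₃ hyR.le).1 hN hz
    · rw [segment_symm] at hz
      exact vertical_run_subset (E := (⟨Ω, δ, ∅, ∅⟩ : DiscreteDobrushin)) hΩ hJE hext hunb hδ
        (by omega : y' ≤ y' + 1) (fun j h1 h2 => by
          rcases (show j = y' ∨ j = y' + 1 by omega) with rfl | rfl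
          · exact hQ
          · exact hN) hz
    · exact hXΩ ⟨hz, hzc⟩
  -- run ⊆ Ω
  have h_runΩ : segment ℝ m ztop ⊆ Ω := by
    exact vertical_run_subset (E := (⟨Ω, δ, ∅, ∅⟩ : DiscreteDobrushin)) hΩ hJE hext hunb hδ hyR.le
      fun j h1 h2 => (hcol j (by omega) h2).1
  -- window
  have h_ball : P ∪ segment ℝ m ztop ⊆ ball a η := by
    rintro z (((hz | hz) | hz) | hz)
    · obtain ⟨him, hre1, hre2⟩ := hmN z hz
      exact hwin z (by linarith) (by linarith) (by rw [him]; nlinarith) (by rw [him]; linarith [hwR1])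
    · obtain ⟨hre, him1, him2⟩ := hNC z hz
      exact hwin z (by rw [hre]; nlinarith) (by rw [hre]; nlinarith) (by nlinarith) (by linarith [hwR1])
    · rcases hXsub hz with h | h
      · obtain ⟨hre, him1, him2⟩ := hdown z h
        exact hwin z (by rw [hre]; nlinarith) (by rw [hre]; nlinarith) (by nlinarith) (by nlinarith)
      · obtain ⟨h1, h2, h3, h4⟩ := hcl' z h
        exact hwin z (by nlinarith) (by nlinarith) (by nlinarith) (by linarith [hwR2])
    · obtain ⟨hre, him1, him2⟩ := hrun z hz
      exact hwin z (by rw [hre]; nlinarith) (by rw [hre]; nlinarith) (by nlinarith) (by nlinarith)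
  -- mesh points of boundary sites are off the leg
  have h_mesh : ∀ x ∈ (⟨Ω, δ, ∅, ∅⟩ : DiscreteDobrushin).zdBoundary, meshPoint δ x ∉ P ∪ segment ℝ m ztop := by
    intro x hx hmem
    have hxΩ : meshPoint δ x ∈ Ω := meshDomain_subset_meshVertices _ _ (DiscreteDobrushin.zdBoundary_subset_meshDomain _ hx)
    rcases hmem with ((hz | hz) | hz) | hz
    · exact meshPoint_im_ne hδ (y' + 1) x (by rw [(hmN _ hz).1]; push_cast; ring) rfl
    · exact meshPoint_re_ne hδ (k + 1) x (by rw [(hNC _ hz).1]; push_cast; ring) rfl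
    · rcases hXΩmem _ hz hxΩ with h | h
      · exact meshPoint_re_ne hδ (k + 1) x (by rw [(hsegP _ h).1]; push_cast; ring) rfl
      · exact meshPoint_not_mem_cell hδ x (k + 1) (y' - 1) h
    · exact meshPoint_re_ne hδ k x (hrun _ hz).1 rfl
  -- the cut edge is an edge of `Ω_δ`
  have h_edge : s(![k + 1, y'], ![k + 2, y']) ∈ (discreteDomainGraph Ω δ).edgeSet := by
    have h := adj_bottom_of_inner hQ
    dsimp only at h
    rw [show k + 1 + 1 = k + 2 by ring] at h
    exact (SimpleGraph.mem_edgeSet (discreteDomainGraph Ω δ)).2 h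
  -- exactly one inner face at the cut edge
  have h_uniq : ∃! f, (⟨Ω, δ, ∅, ∅⟩ : DiscreteDobrushin).IsInnerFace f ∧ IsCorner ![k + 1, y'] f ∧ IsCorner ![k + 2, y'] f := by
    refine ⟨![k + 1, y'], ⟨hQ, isCorner_vec_iff.2 (Or.inl rfl), isCorner_vec_iff.2 (Or.inr (Or.inl (by simp; ring)))⟩, ?_⟩
    rintro f ⟨hf, h1, h2⟩
    rcases face_eq_of_isCorner_h h1 (by simpa [show k + 1 + 1 = k + 2 by ring] using h2) with h | h
    · exact h
    · rw [h] at hf; exact absurd hf hQ'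
  -- pstar is the midpoint of the cut edge
  have h_pstar_eq : Pstar = (2⁻¹ : ℝ) • (meshPoint δ ![k + 1, y'] + meshPoint δ ![k + 2, y']) := by
    rw [hPeq, hueq, hveq]; apply Complex.ext
    · simp only [add_re, Complex.real_smul, mul_re, ofReal_re, ofReal_im, zero_mul, sub_zero]; ring
    · simp only [add_im, Complex.real_smul, mul_im, ofReal_re, ofReal_im, zero_mul, add_zero]; ring
  -- P ⊆ closedBall c (5δ)
  have h_closedBall : P ⊆ closedBall c (5 * δ) := by
    intro z hz
    rw [mem_closedBall]
    rcases hz with (hz | hz) | hz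
    · obtain ⟨him, hre1, hre2⟩ := hmN z hz
      refine (dist_le_of_abs_le (a := 2 * δ) (b := 3 * δ) (abs_le.2 ⟨by nlinarith, by nlinarith⟩)
        (abs_le.2 ⟨by nlinarith, by nlinarith⟩)).trans (by linarith)
    · obtain ⟨hre, him1, him2⟩ := hNC z hz
      refine (dist_le_of_abs_le (a := δ) (b := 3 * δ) (abs_le.2 ⟨by nlinarith, by nlinarith⟩)
        (abs_le.2 ⟨by nlinarith, by nlinarith⟩)).trans (by linarith)
    · rcases hXsub hz with h | h
      · obtain ⟨hre, him1, him2⟩ := hdown z h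
        refine (dist_le_of_abs_le (a := δ) (b := 2 * δ) (abs_le.2 ⟨by nlinarith, by nlinarith⟩)
          (abs_le.2 ⟨by nlinarith, by nlinarith⟩)).trans (by linarith)
      · obtain ⟨h1, h2, h3, h4⟩ := hcl' z h
        refine (dist_le_of_abs_le (a := δ) (b := δ) (abs_le.2 ⟨by nlinarith, by nlinarith⟩)
          (abs_le.2 ⟨by nlinarith, by nlinarith⟩)).trans (by linarith)
  -- dist u c
  have h_du : dist (meshPoint δ ![k + 1, y']) c ≤ 5 * δ := by
    rw [hueq]
    refine (dist_le_of_abs_le (a := δ) (b := δ) (abs_le.2 ⟨by simp only; nlinarith, by simp only; nlinarith⟩)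
      (abs_le.2 ⟨by simp only; nlinarith, by simp only; nlinarith⟩)).trans (by linarith)
  -- dist v c
  have h_dv : dist (meshPoint δ ![k + 2, y']) c ≤ 5 * δ := by
    rw [hveq]
    refine (dist_le_of_abs_le (a := δ) (b := δ) (abs_le.2 ⟨by simp only; nlinarith, by simp only; nlinarith⟩)
      (abs_le.2 ⟨by simp only; nlinarith, by simp only; nlinarith⟩)).trans (by linarith)
  -- closed `Ω_δ`-edges between boundary sites meet the leg only in `pstar`
  have h_edges : ∀ x ∈ (⟨Ω, δ, ∅, ∅⟩ : DiscreteDobrushin).zdBoundary, ∀ y ∈ (⟨Ω, δ, ∅, ∅⟩ : DiscreteDobrushin).zdBoundary,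
      (discreteDomainGraph Ω δ).Adj x y → (P ∪ segment ℝ m ztop) ∩ segment ℝ (meshPoint δ x) (meshPoint δ y) ⊆ {Pstar} := by
    intro x hx y hy hxy z hz
    obtain ⟨hz1, hz2⟩ := hz
    rw [mem_singleton_iff]
    have hxy' : (zdGraph 2).Adj x y := meshGraph_le_zdGraph _ _ (discreteDomainGraph_le_meshGraph _ _ hxy)
    have hzg : z ∈ gridLines δ := segment_meshPoint_subset_gridLines δ hxy' hz2
    have hxΩ : meshPoint δ x ∈ Ω := meshDomain_subset_meshVertices _ _ (DiscreteDobrushin.zdBoundary_subset_meshDomain _ hx)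
    have hyΩ : meshPoint δ y ∈ Ω := meshDomain_subset_meshVertices _ _ (DiscreteDobrushin.zdBoundary_subset_meshDomain _ hy)
    have hmem : ∀ w : Site 2, w ∈ s(x, y) → w ∈ (⟨Ω, δ, ∅, ∅⟩ : DiscreteDobrushin).zdBoundary := fun w hw => by
      rcases Sym2.mem_iff.1 hw with h' | h'
      · rw [h']; exact hx
      · rw [h']; exact hy
    rcases hz1 with ((hz1 | hz1) | hz1) | hz1
    · -- on the east step: the only grid point is the midpoint of the side `x = k+1` at row `y'+1`
      exfalso
      have hzeq := eq_of_mem_horizontal_step_of_mem_gridLines hδ hz1 hzg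
      rw [hzeq] at hz2
      have hs := sym2_eq_of_midpoint_mem_segment_v hδ hxy' (k := k + 1) (n := y' + 1) (by push_cast at hz2 ⊢; exact hz2)
      refine hside₁ ⟨hmem _ (by rw [hs]; exact Sym2.mem_mk_left _ _), ?_⟩
      have := hmem _ (by rw [hs]; exact Sym2.mem_mk_right _ _)
      rwa [show y' + 1 + 1 = y' + 2 by ring] at this
    · -- on the south step: the only grid point is the midpoint of the top side of `(k+1, y')`
      exfalso
      rw [segment_symm] at hz1
      obtain ⟨n, hn1, hn2, hzn⟩ := exists_eq_of_mem_vertical_run_of_mem_gridLines hδ (by omega : y' ≤ y' + 1) hz1 hzg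
      have hn : n = y' + 1 := by omega
      rw [hzn, hn] at hz2
      have hs := sym2_eq_of_midpoint_mem_segment_h hδ hxy' (k := k + 1) (n := y' + 1) (by push_cast at hz2 ⊢; exact hz2)
      refine hside₂ ⟨hmem _ (by rw [hs]; exact Sym2.mem_mk_left _ _), ?_⟩
      have := hmem _ (by rw [hs]; exact Sym2.mem_mk_right _ _)
      rwa [show k + 1 + 1 = k + 2 by ring] at this
    · by_cases hzΩ : z ∈ Ω
      · rcases hXΩmem z hz1 hzΩ with h | h
        · exact eq_midpoint_of_mem_segment_of_mem_gridLines hδ hadj (hsegP_sub h) hzg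
        · exact absurd hzg (cell_subset_compl_gridLines hδ (k + 1) (y' - 1) h)
      · have hzc : z = c := by
          by_contra hne; exact hzΩ (hXΩ ⟨hz1, hne⟩)
        rcases hc_cases with h | h | ⟨x', hx'⟩
        · rw [hzc, h]
        · rw [hzc] at hzg; exact absurd hzg (cell_subset_compl_gridLines hδ (k + 1) (y' - 1) h)
        · exfalso
          rw [hzc, hx'] at hz2
          refine hcΩ (hx' ▸ ?_)
          rcases eq_or_eq_of_meshPoint_mem_segment hδ hxy' hz2 with h' | h'
          · rw [h']; exact hxΩ
          · rw [h']; exact hyΩ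
    · obtain ⟨n, hn1, hn2, hzn⟩ := exists_eq_of_mem_vertical_run_of_mem_gridLines hδ hyR.le hz1 hzg
      exfalso
      rw [hzn] at hz2
      have hs := sym2_eq_of_midpoint_mem_segment_h hδ hxy' hz2
      have h1 : (![k, n] : Site 2) ∈ (⟨Ω, δ, ∅, ∅⟩ : DiscreteDobrushin).zdBoundary := hmem _ (by rw [hs]; exact Sym2.mem_mk_left _ _)
      have h2 : (![k + 1, n] : Site 2) ∈ (⟨Ω, δ, ∅, ∅⟩ : DiscreteDobrushin).zdBoundary := hmem _ (by rw [hs]; exact Sym2.mem_mk_right _ _)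
      have := (hcol (n - 1) (by omega) (by omega)).2
      rw [show n - 1 + 1 = n by ring] at this
      exact this ⟨h1, h2⟩
  -- the local picture at the cut edge (`…ExistsLegLocal`)
  have hX₀ : δ * k + δ = δ * ((k + 1 : ℤ) : ℝ) := by push_cast; ring
  have h_ballΩ : ball z₀ (δ / 8) ⊆ Ω := sectorBall_subset hδ (X₀ := δ * k + δ) (Y₀ := δ * y') hX₀ rfl hfull
  have h_sector := inter_sectorBall_subset (L := P ∪ segment ℝ m ztop) hδ (X₀ := δ * k + δ) (Y₀ := δ * y')
    hX₀ rfl hfull hueq hveq hre_or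
  have h_acc_u := access_u_local (L := P ∪ segment ℝ m ztop) hδ (X₀ := δ * k + δ) (Y₀ := δ * y')
    hX₀ rfl hfull hueq hveq huΩ hre_or
  have h_acc_v := access_v_local (L := P ∪ segment ℝ m ztop) hδ (X₀ := δ * k + δ) (Y₀ := δ * y')
    hX₀ rfl hfull hueq hveq hvΩ hre_or
  have h_box_v := box_v_local (L := P ∪ segment ℝ m ztop) hδ (X₀ := δ * k + δ) (Y₀ := δ * y') hX₀ hveq hre_or
  have h_box_u := box_u_local (L := P ∪ segment ℝ m ztop) hδ (X₀ := δ * k + δ) (Y₀ := δ * y') hX₀ hueq hre_or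
  exact ⟨⟨c, m, ztop, Pstar, z₀, δ / 8, ![k + 1, y'], ![k + 2, y'], 0, P,
    by rw [vec_add_cornerUnit_zero]; simp [show k + 1 + 1 = k + 2 by ring],
    h_arcP, h_m_ne, h_inter, hc_fr, h_PΩ, h_runΩ, h_ball, hp, h_mesh, huB, hvB, h_edge, h_uniq,
    Or.inr (hsegX (right_mem_segment _ _ _)), h_pstar_eq,
    h_closedBall, h_du, h_dv, h_edges, Or.inr (hsegX hz₀seg),
    by positivity, by linarith, h_ballΩ, h_sector, h_acc_u, h_acc_v, h_box_v, h_box_u, ⟨hnd.2, hnd.1⟩⟩⟩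

end Summit.CriticalPhenomena.CardyFormulaZ2.Theorems.DiscretisationFamilyExists

end
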